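import Literature.AnabelianGeometry.SemiGraphs.TemperedCompactInVerticialOfFixedSystems
import Literature.AnabelianGeometry.SemiGraphs.TreeSystemFixedPoint
import HarnessLib

/-!
# [SemiAnbd] Thm 3.7 (iii) beyond finite `𝔾`: the compatible fixed system from FINITE fixed fibres (G2·E1-V, König step)

Mochizuki, *Semi-graphs of anabelioids*, Publ. RIMS **42** (2006), §3, Theorem 3.7 (iii), manuscript
p. 41 ("we may assume that there exists a compatible system of vertices of `𝒢_{∞,j}`, for `j ∈ J`, each
of which is fixed by `H`") [cite: MochizukiSemiAnbd2006, Thm 3.7(iii) p.41]; the author's *Comments*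
(2020), item (6).

PROOF-ONLY (cell abc-iut, layer L3, GAP row G-t6g3-2b, sub-row **G2·E1-V** «vertical growth over a
persistent base vertex», L3-lead ruling α31; seat abc-iut-w4-d080; no definition, no new named fact).
Bricks B1–B3 (`TemperedCompactInVerticialOfFixedSystems.lean`, abc-iut-L3-t10;
`TemperedCompactInVerticialAtOfFixedSystems.lean`, abc-iut-w4-d083) reduce Thm 3.7 (iii) at a countable `𝒢`
to the fixed-systems input (FIX∞), whose first clause `hfix` asks, for a compact `C ≠ 1`, for a COMPATIBLE
system of `C`-fixed vertices of the trees of the level data `D : VerticialLevelData 𝒢 c`.  Print obtains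
compatibility from finiteness ("Since the semi-graphs `𝔾_j` are all finite", p. 41).  This file isolates
the finiteness that the compatibility step REALLY uses — Kőnig's lemma over the directed levels
(abc-iut-L3-t6's `SemiGraph.exists_compatible_of_finite`) needs only that a trans-STABLE family of `C`-fixed
tree vertices be FINITE and nonempty at every level:

* `VerticialLevelData.hfix_of_finite_fixed_family` — any family `A j` of `C`-fixed vertices of `D.tree j`,
  nonempty, FINITE, and mapped into itself by the transition maps, contains a compatible system: `hfix`;
* `VerticialLevelData.hfix_of_finite_fixed_over` — **G2·E1-V, Kőnig step**: if `C` fixes, at every level, a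
  tree vertex over a FIXED base vertex `v` of `𝒢` («persistent base vertex»: no horizontal escape) and the
  `C`-fixed tree vertices over `v` are FINITELY many at every level («no vertical escape over `v`»), then
  `hfix` holds for `C` (the transition maps are over `𝔾` and equivariant, so "`C`-fixed over `v`" is
  trans-stable);
* `VerticialLevelData.hfix_of_finite_fixed` — the special case "all `C`-fixed vertices finite at every level".

What this does NOT give (SHAPES G2·E1-V, abc-iut-w4-d080, for abc-iut-L3-t10's §(f)): at the canonical
Galois tower the level fibre over `v` is finite, but the `C`-fixed TREE vertices over one level vertex form
a torsor under the centraliser of `C`'s (finite) image in the (free) deck group of that level — finite iff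
that centraliser is trivial; an infinite one means `C` fixes a bi-infinite geodesic of the tree.  So the
residual of G2·E1-V at the canonical tower is «no compact `C ≠ 1` centralises a nontrivial deck
transformation cofinally» (sub-row G2·E1-V-tor), NOT a formal (I2)-lifting.  At abc-iut-w4-d075's `𝒢⋆` the
hypotheses hold (finite trees), the conclusion holds — nothing false is asserted.  Nothing here asserts
(FIX∞) for an infinite `𝔾`; nothing bears on [IUTchIII] Cor. 3.12.
-/

namespace Literature.AnabelianGeometry.SemiGraphs

namespace ProfiniteSemiGraph

namespace VerticialLevelData

open CategoryTheory Topology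

universe v u

variable {𝒢 : ProfiniteSemiGraph.{u}} {c : TemperedPiChart 𝒢} (D : VerticialLevelData.{v} 𝒢 c)

/-- **Kőnig for fixed vertices**: a family `A j ⊆ Vert(D.tree j)` of `C`-fixed vertices that is nonempty,
FINITE and stable under the transition maps contains a compatible system of `C`-fixed vertices — the
first clause `hfix` of (FIX∞) for `C` (abc-iut-L3-t6's `SemiGraph.exists_compatible_of_finite` over the
directed levels; print p. 41 "we may choose a compatible system").
[cite: MochizukiSemiAnbd2006, Thm 3.7(iii) p.41] -/
theorem hfix_of_finite_fixed_family (C : Subgroup c.G) (A : ∀ j : D.J, Set (D.tree j).Vertex)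
    (hA : ∀ j, ∀ x ∈ A j, ∀ g ∈ C, (D.act j g).hom.vertexMap x = x)
    (hne : ∀ j, (A j).Nonempty) (hfin : ∀ j, (A j).Finite)
    (hmap : ∀ ⦃i j : D.J⦄ (h : i ≤ j), ∀ x ∈ A j, (D.trans h).vertexMap x ∈ A i) :
    ∃ x : ∀ j, (D.tree j).Vertex, (∀ ⦃i j : D.J⦄ (h : i ≤ j), (D.trans h).vertexMap (x j) = x i) ∧
      ∀ g ∈ C, ∀ j, (D.act j g).hom.vertexMap (x j) = x j := by
  obtain ⟨x, hxA, hxc⟩ := SemiGraph.exists_compatible_of_finite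
    (fun i j (h : i ≤ j) => (D.trans h).vertexMap) (fun j x => D.trans_vertexMap_refl j x)
    (fun i j k hij hjk x => D.trans_vertexMap_comp hij hjk x) A hfin hne
    (fun i j h x hx => hmap h x hx)
  exact ⟨x, hxc, fun g hg j => hA j (x j) (hxA j) g hg⟩

/-- **G2·E1-V (Kőnig step): a persistent base vertex with finite fixed fibres gives the compatible fixed
system.**  If the compact subgroup `C` fixes, at every level `j`, some vertex of `D.tree j` lying over the
base vertex `v` of `𝒢`, and only FINITELY many vertices of `D.tree j` over `v` are fixed by `C`, then `C`
fixes a compatible system of tree vertices (`hfix` of (FIX∞)): the transition maps are over `𝔾`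
(`trans_over`) and equivariant (`trans_act`), so "`C`-fixed and over `v`" is a finite nonempty trans-stable
family. [cite: MochizukiSemiAnbd2006, Thm 3.7(iii) p.41] -/
theorem hfix_of_finite_fixed_over (C : Subgroup c.G) (v : 𝒢.graph.Vertex)
    (hne : ∀ j, ∃ x : (D.tree j).Vertex, (D.proj j).vertexMap x = v ∧
      ∀ g ∈ C, (D.act j g).hom.vertexMap x = x)
    (hfin : ∀ j, {x : (D.tree j).Vertex | (D.proj j).vertexMap x = v ∧
      ∀ g ∈ C, (D.act j g).hom.vertexMap x = x}.Finite) :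
    ∃ x : ∀ j, (D.tree j).Vertex, (∀ ⦃i j : D.J⦄ (h : i ≤ j), (D.trans h).vertexMap (x j) = x i) ∧
      ∀ g ∈ C, ∀ j, (D.act j g).hom.vertexMap (x j) = x j := by
  refine D.hfix_of_finite_fixed_family C
    (fun j => {x : (D.tree j).Vertex | (D.proj j).vertexMap x = v ∧
      ∀ g ∈ C, (D.act j g).hom.vertexMap x = x})
    (fun j x hx => hx.2) (fun j => let ⟨x, hx⟩ := hne j; ⟨x, hx⟩) hfin ?_
  rintro i j h x ⟨hxv, hxf⟩
  refine ⟨?_, fun g hg => ?_⟩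
  · -- over `𝔾`: `proj i (trans h x) = proj j x = v`
    have e := congrArg (fun φ => SemiGraph.Hom.vertexMap φ x) (D.trans_over h)
    simp only [SemiGraph.comp_vertexMap, Function.comp_apply] at e
    rw [e, hxv]
  · -- equivariance: `g · trans h x = trans h (g · x) = trans h x`
    rw [← D.trans_act_vertexMap h g x, hxf g hg]

/-- **Special case: finitely many fixed vertices at every level** (e.g. finite trees): a compact `C`
fixing some vertex at every level, with FINITE fixed-vertex sets, fixes a compatible system.
[cite: MochizukiSemiAnbd2006, Thm 3.7(iii) p.41] -/
theorem hfix_of_finite_fixed (C : Subgroup c.G)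
    (hne : ∀ j, ∃ x : (D.tree j).Vertex, ∀ g ∈ C, (D.act j g).hom.vertexMap x = x)
    (hfin : ∀ j, {x : (D.tree j).Vertex | ∀ g ∈ C, (D.act j g).hom.vertexMap x = x}.Finite) :
    ∃ x : ∀ j, (D.tree j).Vertex, (∀ ⦃i j : D.J⦄ (h : i ≤ j), (D.trans h).vertexMap (x j) = x i) ∧
      ∀ g ∈ C, ∀ j, (D.act j g).hom.vertexMap (x j) = x j := by
  refine D.hfix_of_finite_fixed_family C
    (fun j => {x : (D.tree j).Vertex | ∀ g ∈ C, (D.act j g).hom.vertexMap x = x})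
    (fun j x hx => hx) (fun j => let ⟨x, hx⟩ := hne j; ⟨x, hx⟩) hfin ?_
  intro i j h x hx g hg
  show (D.act i g).hom.vertexMap ((D.trans h).vertexMap x) = (D.trans h).vertexMap x
  rw [← D.trans_act_vertexMap h g x, hx g hg]

end VerticialLevelData

end ProfiniteSemiGraph

end Literature.AnabelianGeometry.SemiGraphs
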